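import Summits.ResolutionOfSingularities.ResolutionOfSingularities.Theorems.FrobeniusClosingPatchingRelPerfectConeDepthLadderStep
import Literature.AlgebraicGeometry.Resolution.RsopMonomialIdeals
import Literature.AlgebraicGeometry.Resolution.MarkedIdealsLemmas
import Literature.AlgebraicGeometry.Resolution.MarkedIdealsArithmetic
import HarnessLib

/-!
# Crux `PatchingRelPerfect` (stmt-ResolutionOfSingularities-16161), chain W5.2 — rung «r-binary-disc-ℓ», LADDER: the state of the
# LINE-centre ladder for the binary form `N(x₀,x₁) = x₀² + b x₀x₁ + a x₁²` (`b² − 4a` a unit), and one rung (blowing up the bad line)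

[OURS · L1 W5.2 · rung tool] Replaces the role of NO printed item; NOT a statement of the manuscript under review; fact-free,
any characteristic, any residue field.  AI-written (AI review is weaker than expert review).

`ConeDepth.LineState I X g M 𝓗 E P₁ P₂ A B a b`: g4's `LadderState` with the vertex replaced by the bad LINE
`Z = V(P₁) ∩ V(P₂) ∩ V(E)` (strict transforms `P₁, P₂` of the two coordinate hyperplanes through the singular plane of the host,
`E` the last exceptional carrier): THE FORMAT `I𝒪_X = M · (𝓗 · mono(A ++ [(E,a)]) ⊔ mono(B ++ [(E,b)]))`, at every point of `Z`
(closed or not) a part `(c₀, c₁, c₂)` of a regular system of parameters reading `E, P₁, P₂, 𝓗` as `(c₀), (c₁), (c₂),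
(c₁² + b c₁c₂ + a c₂²)` with `b² − 4a` a unit, the other carriers missing `Z`, and simple normal crossings of `𝓗 :: carriers` off `Z`
over the closed point.
PROVED here: the host lies in the square of the centre `𝓩 = P₁ ⊔ P₂ ⊔ E`, host ≠ carrier, and `conclusion_of_zero` (THE END at
`b = 0`); the rung `step` (blowing up `𝓩`) is the sequel file `…LineStep`.

## References
* J. Kollár, *Lectures on Resolution of Singularities* (2007), 3.61, (3.111) Step 3. [Kollar2007]
* Q. Liu, *Algebraic Geometry and Arithmetic Curves*, OUP 2002, Thm. 8.1.19 (a). [Liu2002]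
* The Stacks Project, Tags 080A, 080B. [StacksProject]
-/

set_option linter.dupNamespace false

noncomputable section

open CategoryTheory CategoryTheory.Limits AlgebraicGeometry TopologicalSpace IsLocalRing
open Literature.AlgebraicGeometry.Resolution
open Scheme.IdealSheafData
open scoped Pointwise

namespace Summit.ResolutionOfSingularities.ResolutionOfSingularities.Theorems

universe u

namespace ConeDepth

/-- **State of the LINE-centre ladder** [OURS · L1 W5.2 · rung tool; cf. Kollár (3.111) Step 3]: as `LadderState`, with the vertex
replaced by the bad line `Z = V(P₁) ∩ V(P₂) ∩ V(E)` carrying, at each of its points, a part `(c₀, c₁, c₂)` of a regular system of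
parameters in which `E, P₁, P₂` read `(c₀), (c₁), (c₂)` and the host reads the binary form `c₁² + b c₁c₂ + a c₂²` with unit
discriminant.
[cite: Kollar2007, (3.111) Step 3 and 3.61] -/
structure LineState {S : Type u} [CommRing S] [IsRegularLocalRing S] (I : Ideal S) (X : Scheme.{u})
    (g : X ⟶ Spec (.of S)) (M 𝓗 E P₁ P₂ : X.IdealSheafData) (A B : List (X.IdealSheafData × ℕ)) (a b : ℕ) : Prop where
  /-- `X` is integral -/
  isIntegral : IsIntegral X
  /-- `X` is Noetherian -/
  isNoetherian : IsNoetherian X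
  /-- `X` is regular -/
  isRegular : Scheme.IsRegular X
  /-- `g` is a blowing up along an ideal sheaf cosupported in the closed point -/
  exists_isBlowup : ∃ K₀ : (Spec (.of S)).IdealSheafData, IsBlowup g K₀ ∧
    (K₀.support : Set (Spec (.of S))) ⊆ {IsLocalRing.closedPoint S}
  /-- the invertible factor is locally principal -/
  isLocallyPrincipal : IsLocallyPrincipal M
  /-- the two exponent lists live on the same boundary -/
  boundaryOf_eq : boundaryOf A = boundaryOf B
  /-- THE FORMAT -/
  format : (affineBlowup.idealSheaf I).comap g =
    M * (𝓗 * monomialIdeal (A ++ [(E, a)]) ⊔ monomialIdeal (B ++ [(E, b)]))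
  /-- the bad line is non-empty -/
  nonempty : ∃ z : X, z ∈ P₁.support ∧ z ∈ P₂.support ∧ z ∈ E.support
  /-- the bad line lies over the closed point -/
  base_eq : ∀ z : X, z ∈ P₁.support → z ∈ P₂.support → z ∈ E.support → g z = IsLocalRing.closedPoint S
  /-- along the bad line: part `(c₀, c₁, c₂)` of a regular system of parameters reading the carrier, the two planes, the host -/
  line : ∀ z : X, z ∈ P₁.support → z ∈ P₂.support → z ∈ E.support →
    ∃ c : Fin 3 → X.presheaf.stalk z, IsRsopPart c ∧
      stalkIdeal E z = Ideal.span {c 0} ∧ stalkIdeal P₁ z = Ideal.span {c 1} ∧ stalkIdeal P₂ z = Ideal.span {c 2} ∧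
      ∃ a' b' : X.presheaf.stalk z, IsUnit (b' ^ 2 - 4 * a') ∧
        stalkIdeal 𝓗 z = Ideal.span {c 1 * c 1 + b' * (c 1 * c 2) + a' * (c 2 * c 2)}
  /-- the other carriers miss the bad line -/
  not_mem_support : ∀ D ∈ boundaryOf A, ∀ z : X, z ∈ P₁.support → z ∈ P₂.support → z ∈ E.support → z ∉ D.support
  /-- simple normal crossings over the closed point, off the bad line -/
  snc : ∀ x : X, g x = IsLocalRing.closedPoint S → ¬ (x ∈ P₁.support ∧ x ∈ P₂.support ∧ x ∈ E.support) →
    DepthSNC.SNCWithAt (𝓗 :: (boundaryOf A ++ [E])) ⊤ x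

namespace LineState

variable {S : Type u} [CommRing S] [IsRegularLocalRing S] {I : Ideal S} {X : Scheme.{u}} {g : X ⟶ Spec (.of S)}
  {M 𝓗 E P₁ P₂ : X.IdealSheafData} {A B : List (X.IdealSheafData × ℕ)} {a b : ℕ}

/-- The stalk of the centre `𝓩 = P₁ ⊔ P₂ ⊔ E` at a point of the bad line is `(c₀, c₁, c₂)`. [folklore] -/
theorem stalkIdeal_centre_eq {z : X} {c : Fin 3 → X.presheaf.stalk z} (hE : stalkIdeal E z = Ideal.span {c 0})
    (hP₁ : stalkIdeal P₁ z = Ideal.span {c 1}) (hP₂ : stalkIdeal P₂ z = Ideal.span {c 2}) :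
    stalkIdeal (P₁ ⊔ P₂ ⊔ E) z = Ideal.span (Set.range c) := by
  rw [stalkIdeal_sup, stalkIdeal_sup, hE, hP₁, hP₂, ← Ideal.span_union, ← Ideal.span_union]
  congr 1
  ext t
  simp only [Set.union_singleton, Set.mem_insert_iff, Set.mem_singleton_iff, Set.mem_range]
  constructor
  · rintro (rfl | rfl | rfl) <;> exact ⟨_, rfl⟩
  · rintro ⟨i, rfl⟩
    fin_cases i <;> simp

/-- Membership in the support of the centre. [folklore] -/
theorem mem_support_centre_iff (x : X) :
    x ∈ (P₁ ⊔ P₂ ⊔ E).support ↔ x ∈ P₁.support ∧ x ∈ P₂.support ∧ x ∈ E.support := by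
  simp only [support_sup, TopologicalSpace.Closeds.coe_inf, ← SetLike.mem_coe, Set.mem_inter_iff, and_assoc]

/-- The host lies in the square of the centre. [folklore] -/
theorem host_le_centre_sq (h : LineState I X g M 𝓗 E P₁ P₂ A B a b) : 𝓗 ≤ (P₁ ⊔ P₂ ⊔ E) ^ 2 := by
  refine le_of_forall_stalkIdeal_le fun x => ?_
  rw [stalkIdeal_pow]
  by_cases hx : x ∈ (P₁ ⊔ P₂ ⊔ E).support
  · obtain ⟨h1, h2, h3⟩ := (mem_support_centre_iff x).mp hx
    obtain ⟨c, -, hE, hP₁, hP₂, a', b', -, h𝓗⟩ := h.line x h1 h2 h3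
    rw [stalkIdeal_centre_eq hE hP₁ hP₂, h𝓗, Ideal.span_singleton_le_iff_mem, pow_two]
    have hm : ∀ i, c i ∈ Ideal.span (Set.range c) := fun i => Ideal.subset_span ⟨i, rfl⟩
    exact Ideal.add_mem _ (Ideal.add_mem _ (Ideal.mul_mem_mul (hm 1) (hm 1))
      (Ideal.mul_mem_left _ _ (Ideal.mul_mem_mul (hm 1) (hm 2)))) (Ideal.mul_mem_left _ _ (Ideal.mul_mem_mul (hm 2) (hm 2)))
  · rw [stalkIdeal_eq_top_of_not_mem_support hx, Ideal.top_pow]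
    exact le_top

/-- At a point of the bad line the host lies in `𝔪²` while the carrier does not. [cite: Matsumura1987, §14] -/
theorem host_ne_carrier (h : LineState I X g M 𝓗 E P₁ P₂ A B a b) : 𝓗 ≠ E := by
  obtain ⟨z, h1, h2, h3⟩ := h.nonempty
  obtain ⟨c, hc, hE, -, -, a', b', -, h𝓗⟩ := h.line z h1 h2 h3
  intro heq
  have h0 : c 0 ∈ Ideal.span {c 1 * c 1 + b' * (c 1 * c 2) + a' * (c 2 * c 2)} := by
    rw [← h𝓗, heq, hE]; exact Ideal.mem_span_singleton_self _
  have hc1 := hc.mem_maximalIdeal 1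
  have hc2 := hc.mem_maximalIdeal 2
  have hsq : c 1 * c 1 + b' * (c 1 * c 2) + a' * (c 2 * c 2) ∈ maximalIdeal (X.presheaf.stalk z) ^ 2 := by
    rw [pow_two]
    exact Ideal.add_mem _ (Ideal.add_mem _ (Ideal.mul_mem_mul hc1 hc1) (Ideal.mul_mem_left _ _ (Ideal.mul_mem_mul hc1 hc2)))
      (Ideal.mul_mem_left _ _ (Ideal.mul_mem_mul hc2 hc2))
  obtain ⟨r, hr⟩ := Ideal.mem_span_singleton'.mp h0
  exact hc.not_mem_sq 0 (by rw [← hr]; exact Ideal.mul_mem_left _ _ hsq)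

/-- Points of the bad line lie on the host. [folklore] -/
theorem mem_support_host (h : LineState I X g M 𝓗 E P₁ P₂ A B a b) {z : X} (h1 : z ∈ P₁.support) (h2 : z ∈ P₂.support)
    (h3 : z ∈ E.support) : z ∈ 𝓗.support := by
  have hle := h.host_le_centre_sq
  rw [mem_support_iff_stalkIdeal_ne_top]
  intro htop
  have hz : z ∈ (P₁ ⊔ P₂ ⊔ E).support := (mem_support_centre_iff z).mpr ⟨h1, h2, h3⟩
  rw [mem_support_iff_stalkIdeal_ne_top] at hz
  apply hz
  have := stalkIdeal_mono hle z
  rw [htop, top_le_iff, stalkIdeal_pow] at this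
  exact top_le_iff.mp (this ▸ Ideal.pow_le_self two_ne_zero)

/-- **THE END applies at exponent `b = 0`**: the conclusion of the blow-up-form core holds for every `T = Bl_I Spec S`.
[cite: Kollar2007, (3.111) Step 3] [cite: StacksProject, Tag 080A] -/
theorem conclusion_of_zero (h : LineState I X g M 𝓗 E P₁ P₂ A B a 0) (hI : I ≠ ⊥)
    (hIm : ((affineBlowup.idealSheaf I).support : Set (Spec (.of S))) ⊆ {IsLocalRing.closedPoint S})
    (T : Scheme.{u}) (f : T ⟶ Spec (.of S)) (hf : IsBlowup f (affineBlowup.idealSheaf I)) :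
    ∃ (J : T.IdealSheafData) (T' : Scheme.{u}) (π : T' ⟶ T), J ≠ ⊥ ∧
      (∀ t : T, t ∈ J.support → f.base t = IsLocalRing.closedPoint S) ∧
      IsBlowup π J ∧ Scheme.IsRegular T' := by
  haveI := h.isNoetherian
  have hK : 𝓗 * monomialIdeal (A ++ [(E, a)]) ⊔ monomialIdeal (B ++ [(E, 0)]) =
      monomialIdeal ((𝓗, 1) :: (A ++ [(E, a)])) ⊔ monomialIdeal ((𝓗, 0) :: (B ++ [(E, 0)])) := by
    rw [monomialIdeal_cons, monomialIdeal_cons, pow_one, pow_zero, Scheme.IdealSheafData.one_eq_top,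
      Scheme.IdealSheafData.top_mul]
  have hfmt := h.format
  rw [hK] at hfmt
  refine coneEnd hI h.isRegular h.exists_isBlowup h.isLocallyPrincipal _ _ ?_ ?_ ?_ hfmt T f hf
  · show 𝓗 :: boundaryOf (A ++ [(E, a)]) = 𝓗 :: boundaryOf (B ++ [(E, 0)])
    rw [boundaryOf_append, boundaryOf_append, h.boundaryOf_eq]
    rfl
  · intro x hx
    have hxI : x ∈ ((affineBlowup.idealSheaf I).comap g).support := by
      rw [hfmt, Scheme.IdealSheafData.support_mul]
      exact Or.inr hx
    have hgx : g x = IsLocalRing.closedPoint S := by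
      rw [Scheme.IdealSheafData.support_comap] at hxI
      exact hIm hxI
    have hxZ : ¬ (x ∈ P₁.support ∧ x ∈ P₂.support ∧ x ∈ E.support) := by
      rintro ⟨h1, h2, h3⟩
      rw [← hK] at hx
      have hB : stalkIdeal (monomialIdeal (B ++ [(E, 0)])) x = ⊤ := by
        rw [stalkIdeal_monomialIdeal, List.map_append, List.prod_append, List.map_singleton, List.prod_singleton,
          pow_zero, mul_one, ← Ideal.one_eq_top]
        refine List.prod_eq_one fun J hJ => ?_
        obtain ⟨p, hp, rfl⟩ := List.mem_map.mp hJ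
        have hD : x ∉ p.1.support := h.not_mem_support p.1 (h.boundaryOf_eq ▸ fst_mem_boundaryOf hp) x h1 h2 h3
        rw [stalkIdeal_eq_top_of_not_mem_support hD, Ideal.top_pow, Ideal.one_eq_top]
      rw [mem_support_iff_stalkIdeal_ne_top, stalkIdeal_sup, hB] at hx
      exact hx (sup_top_eq _)
    have := h.snc x hgx hxZ
    show DepthSNC.SNCWithAt (𝓗 :: boundaryOf (A ++ [(E, a)])) ⊤ x
    rwa [boundaryOf_append]
  · intro x hx
    have hxI : x ∈ ((affineBlowup.idealSheaf I).comap g).support := by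
      rw [hfmt, Scheme.IdealSheafData.support_mul]
      exact Or.inr hx
    rw [Scheme.IdealSheafData.support_comap] at hxI
    exact hIm hxI

end LineState

end ConeDepth

end Summit.ResolutionOfSingularities.ResolutionOfSingularities.Theorems

end
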